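import Mathlib
import Literature.AlgebraicGeometry.Resolution.CobordantTupleGame

/-!
# The coefficient-tuple game: inductive winning region and rank extraction

[OURS · L1 W4.3 · chain w43, Track T4 (tame double points at N = 4); stub worker 4] Folklore-type infrastructure for the
engine crux `LocalWeightedDrop` of route ResolutionOfSingularities/WeightedInvariant (stmt-ResolutionOfSingularities-8899),
Summits-side companion of `Literature/…/CobordantTupleGame` (`TupleGame.Drop k m e`: ONE ordinal rank on
coefficient tuples dropping at every bad successor of some move = order reduction of the marked coefficient ideal
`(a_j, e + 2 - j)_j` on `k⟦x_0,…,x_{m-1}⟧` in positional form).  Exactly as `CobordantGame` does for the hypersurface game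
(`Won`, `WonBy`, `hasRank_iff_allWon`), this file records the tuple game in INDUCTIVE form and proves the equivalence of
the two formulations, so that strategies obtained by induction along a resolution sequence (rather than by an explicit
rank) can be landed as proofs of `Drop`:

* `TWon k m e a` — the inductive winning region: some move (coordinate change `Φ`, weights `w ∈ {0,1}^m ∖ 0`, and a
  SLOT SELECTOR `sel` naming at every exceptional point a live slot) all of whose non-zero bad successors (sliced at the
  selected slot) are won.  The selector replaces the `∃ i` of `StepDrop` (classically equivalent, `tWon_iff_step`), which
  keeps the inductive strictly positive;
* `TWonBy k α m e a` — won with game value `≤ α` (well-founded recursion on the ordinal), `TWon ↔ ∃ α, TWonBy α`;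
* `drop_of_allTWon` — if every non-zero bad tuple is in `TWon` then `Drop k m e` (`κ :=` least value);
  `allTWon_of_drop` — conversely; `drop_iff_allTWon`.

Design: plain statements over an arbitrary field `k : Type` with the quantifier shapes of `TupleGame.StepDrop` verbatim.
Deliberately NOT here: any specific strategy (plane case: Summits `TameLift.tupleDropPlane`; dimension three: open /
conditional on printed embedded resolution of idealistic exponents on regular threefolds).
-/

set_option linter.dupNamespace false -- mandated namespace of this single-conjunct summit

namespace Summit.ResolutionOfSingularities.ResolutionOfSingularities.Theorems.TupleGame

open MvPowerSeries Literature.AlgebraicGeometry.Resolution Literature.AlgebraicGeometry.Resolution.TupleGame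

variable (k : Type) [Field k]

/-- The data of ONE MOVE of the tuple game from `a` with a slot selector, and what it requires of a successor predicate `Q`:
a legal coordinate change `Φ` (zero constant terms, invertible linear part), weights `w ∈ {0,1}^m` with some `w_i = 1`, a
selector `sel` choosing at every exceptional point `c ≠ 0` (vanishing on the weight-`0` slots) and factorisation data `D, G`
a LIVE slot (`c (sel c D G) ≠ 0`), such that the successor tuple sliced there, if non-zero and bad, satisfies `Q`.
(`StepDrop κ P a` is `∃ Φ w sel, IsTMove Φ w sel a (fun b => P b ∧ κ b < κ a)` — `isTMove_iff_stepDrop`.) [OURS · folklore] -/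
def IsTMove {m e : ℕ} (Φ : Fin m → MvPowerSeries (Fin m) k) (w : Fin m → ℕ)
    (sel : (Fin m → k) → (Fin (e + 1) → ℕ) → (Fin (e + 1) → MvPowerSeries (Fin (m + 1)) k) → Fin m)
    (a : Fin (e + 1) → MvPowerSeries (Fin m) k) (Q : (Fin (e + 1) → MvPowerSeries (Fin m) k) → Prop) : Prop :=
  (∀ i, constantCoeff (Φ i) = 0) ∧
    IsUnit (Matrix.det (Matrix.of fun i j => coeff (Finsupp.single j 1) (Φ i))) ∧
    (∀ i, w i ≤ 1) ∧ (∃ i, 0 < w i) ∧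
    ∀ c : Fin m → k, (∀ i, w i = 0 → c i = 0) → c ≠ 0 →
      ∀ (D : Fin (e + 1) → ℕ) (G : Fin (e + 1) → MvPowerSeries (Fin (m + 1)) k),
        (∀ j, a j ≠ 0 →
          subst (CobordantChart.chart w c) (subst Φ (a j)) = X 0 ^ D j * G j ∧ ¬ X 0 ∣ G j) →
        c (sel c D G) ≠ 0 ∧ (newTuple a D G (sel c D G) ≠ 0 → Bad (newTuple a D G (sel c D G)) →
          Q (newTuple a D G (sel c D G)))

variable {k} in
/-- `IsTMove` is monotone in the successor predicate. [OURS · folklore] -/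
theorem IsTMove.mono {m e : ℕ} {Φ : Fin m → MvPowerSeries (Fin m) k} {w : Fin m → ℕ}
    {sel : (Fin m → k) → (Fin (e + 1) → ℕ) → (Fin (e + 1) → MvPowerSeries (Fin (m + 1)) k) → Fin m}
    {a : Fin (e + 1) → MvPowerSeries (Fin m) k} {Q Q' : (Fin (e + 1) → MvPowerSeries (Fin m) k) → Prop}
    (h : IsTMove k Φ w sel a Q) (hQ : ∀ b, b ≠ 0 → Bad b → Q b → Q' b) : IsTMove k Φ w sel a Q' := by
  obtain ⟨h0, hdet, hw1, hw, hs⟩ := h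
  refine ⟨h0, hdet, hw1, hw, fun c hc0 hc D G hDG => ?_⟩
  obtain ⟨hlive, hsucc⟩ := hs c hc0 hc D G hDG
  exact ⟨hlive, fun hne hbad => hQ _ hne hbad (hsucc hne hbad)⟩

variable {k} in
/-- `StepDrop κ P a` unfolded through a slot selector: the `∃ i` after `∀ c D G` is a choice function. [OURS · folklore] -/
theorem isTMove_iff_stepDrop {m e : ℕ} (κ : (Fin (e + 1) → MvPowerSeries (Fin m) k) → Ordinal.{0})
    (P : (Fin (e + 1) → MvPowerSeries (Fin m) k) → Prop) (a : Fin (e + 1) → MvPowerSeries (Fin m) k) :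
    (∃ Φ w sel, IsTMove k Φ w sel a (fun b => P b ∧ κ b < κ a)) ↔ StepDrop κ P a := by
  constructor
  · rintro ⟨Φ, w, sel, h0, hdet, hw1, hw, hs⟩
    refine ⟨Φ, w, h0, hdet, hw1, hw, fun c hc0 hc D G hDG => ?_⟩
    obtain ⟨hlive, hsucc⟩ := hs c hc0 hc D G hDG
    exact ⟨sel c D G, hlive, hsucc⟩
  · rintro ⟨Φ, w, h0, hdet, hw1, hw, hs⟩
    classical
    -- choose the slot at every (c, D, G) where the hypotheses hold; elsewhere any slot of positive weight
    obtain ⟨i₀, hi₀⟩ := hw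
    refine ⟨Φ, w, fun c D G =>
      if h : (∀ i, w i = 0 → c i = 0) ∧ c ≠ 0 ∧ (∀ j, a j ≠ 0 →
          subst (CobordantChart.chart w c) (subst Φ (a j)) = X 0 ^ D j * G j ∧ ¬ X 0 ∣ G j)
      then Classical.choose (hs c h.1 h.2.1 D G h.2.2) else i₀,
      h0, hdet, hw1, ⟨i₀, hi₀⟩, fun c hc0 hc D G hDG => ?_⟩
    have hcond : (∀ i, w i = 0 → c i = 0) ∧ c ≠ 0 ∧ (∀ j, a j ≠ 0 →
        subst (CobordantChart.chart w c) (subst Φ (a j)) = X 0 ^ D j * G j ∧ ¬ X 0 ∣ G j) := ⟨hc0, hc, hDG⟩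
    simp only [dif_pos hcond]
    exact Classical.choose_spec (hs c hc0 hc D G hDG)

/-- The WINNING REGION of the tuple game (inductive form): `a` is won if some move with slot selector has all its non-zero
bad successors won.  A tuple with a move without non-zero bad successors is won outright.  (The liveness of the selected
slot and the successor clause are separate fields, keeping the inductive strictly positive; `TWon.of_isTMove` /
`TWon.exists_isTMove` convert to and from `IsTMove`.) [OURS · folklore] -/
inductive TWon (m e : ℕ) : (Fin (e + 1) → MvPowerSeries (Fin m) k) → Prop
  | move {a : Fin (e + 1) → MvPowerSeries (Fin m) k} (Φ : Fin m → MvPowerSeries (Fin m) k) (w : Fin m → ℕ)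
      (sel : (Fin m → k) → (Fin (e + 1) → ℕ) → (Fin (e + 1) → MvPowerSeries (Fin (m + 1)) k) → Fin m)
      (h0 : ∀ i, constantCoeff (Φ i) = 0)
      (hdet : IsUnit (Matrix.det (Matrix.of fun i j => coeff (Finsupp.single j 1) (Φ i))))
      (hw1 : ∀ i, w i ≤ 1) (hw : ∃ i, 0 < w i)
      (hlive : ∀ c : Fin m → k, (∀ i, w i = 0 → c i = 0) → c ≠ 0 →
        ∀ (D : Fin (e + 1) → ℕ) (G : Fin (e + 1) → MvPowerSeries (Fin (m + 1)) k),
          (∀ j, a j ≠ 0 →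
            subst (CobordantChart.chart w c) (subst Φ (a j)) = X 0 ^ D j * G j ∧ ¬ X 0 ∣ G j) →
          c (sel c D G) ≠ 0)
      (h : ∀ c : Fin m → k, (∀ i, w i = 0 → c i = 0) → c ≠ 0 →
        ∀ (D : Fin (e + 1) → ℕ) (G : Fin (e + 1) → MvPowerSeries (Fin (m + 1)) k),
          (∀ j, a j ≠ 0 →
            subst (CobordantChart.chart w c) (subst Φ (a j)) = X 0 ^ D j * G j ∧ ¬ X 0 ∣ G j) →
          newTuple a D G (sel c D G) ≠ 0 → Bad (newTuple a D G (sel c D G)) →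
            TWon m e (newTuple a D G (sel c D G))) : TWon m e a

variable {k} in
/-- Constructor of `TWon` from an `IsTMove` all of whose successors are won. [OURS · folklore] -/
theorem TWon.of_isTMove {m e : ℕ} {a : Fin (e + 1) → MvPowerSeries (Fin m) k} {Φ : Fin m → MvPowerSeries (Fin m) k}
    {w : Fin m → ℕ} {sel : (Fin m → k) → (Fin (e + 1) → ℕ) → (Fin (e + 1) → MvPowerSeries (Fin (m + 1)) k) → Fin m}
    (h : IsTMove k Φ w sel a (TWon k m e)) : TWon k m e a := by
  obtain ⟨h0, hdet, hw1, hw, hs⟩ := h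
  exact TWon.move Φ w sel h0 hdet hw1 hw (fun c hc0 hc D G hDG => (hs c hc0 hc D G hDG).1)
    (fun c hc0 hc D G hDG => (hs c hc0 hc D G hDG).2)

variable {k} in
/-- Destructor of `TWon`: some `IsTMove` has all its successors won. [OURS · folklore] -/
theorem TWon.exists_isTMove {m e : ℕ} {a : Fin (e + 1) → MvPowerSeries (Fin m) k} (h : TWon k m e a) :
    ∃ Φ w sel, IsTMove k Φ w sel a (TWon k m e) := by
  obtain ⟨Φ, w, sel, h0, hdet, hw1, hw, hlive, hs⟩ := h
  exact ⟨Φ, w, sel, h0, hdet, hw1, hw, fun c hc0 hc D G hDG => ⟨hlive c hc0 hc D G hDG, hs c hc0 hc D G hDG⟩⟩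

/-- `TWonBy α m e a`: `a` is won with game value `≤ α` — some move all of whose non-zero bad successors are won with value
`< α`.  Defined by well-founded recursion on the ordinal. [OURS · folklore] -/
def TWonBy : Ordinal.{0} → (m e : ℕ) → (Fin (e + 1) → MvPowerSeries (Fin m) k) → Prop
  | α, m, e, a => ∃ (Φ : Fin m → MvPowerSeries (Fin m) k) (w : Fin m → ℕ)
      (sel : (Fin m → k) → (Fin (e + 1) → ℕ) → (Fin (e + 1) → MvPowerSeries (Fin (m + 1)) k) → Fin m),
      IsTMove k Φ w sel a (fun b => ∃ (β : Ordinal.{0}) (_ : β < α), TWonBy β m e b)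
  termination_by α => α

variable {k}

/-- Unfolding of `TWonBy`. [OURS · folklore] -/
theorem tWonBy_iff (α : Ordinal.{0}) {m e : ℕ} (a : Fin (e + 1) → MvPowerSeries (Fin m) k) :
    TWonBy k α m e a ↔ ∃ Φ w sel, IsTMove k Φ w sel a (fun b => ∃ β, β < α ∧ TWonBy k β m e b) := by
  rw [TWonBy]
  simp only [exists_prop]

/-- `TWonBy` is monotone in the ordinal. [OURS · folklore] -/
theorem TWonBy.mono {α α' : Ordinal.{0}} (hle : α ≤ α') {m e : ℕ} {a : Fin (e + 1) → MvPowerSeries (Fin m) k}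
    (h : TWonBy k α m e a) : TWonBy k α' m e a := by
  rw [tWonBy_iff] at h ⊢
  obtain ⟨Φ, w, sel, hmv⟩ := h
  exact ⟨Φ, w, sel, hmv.mono fun b _ _ ⟨β, hβ, hb⟩ => ⟨β, lt_of_lt_of_le hβ hle, hb⟩⟩

/-- `TWonBy α` implies `TWon`. [OURS · folklore] -/
theorem TWonBy.tWon {α : Ordinal.{0}} : ∀ {m e : ℕ} {a : Fin (e + 1) → MvPowerSeries (Fin m) k},
    TWonBy k α m e a → TWon k m e a := by
  induction α using WellFoundedLT.induction with
  | ind α ih =>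
    intro m e a h
    rw [tWonBy_iff] at h
    obtain ⟨Φ, w, sel, hmv⟩ := h
    exact TWon.of_isTMove (hmv.mono fun b _ _ ⟨β, hβ, hb⟩ => ih β hβ hb)

/-- `TWon` implies `TWonBy α` for some ordinal `α` (the successors of a tuple form a small family, so the supremum of their
values exists in `Ordinal.{0}`). [OURS · folklore] -/
theorem TWon.exists_tWonBy {m e : ℕ} {a : Fin (e + 1) → MvPowerSeries (Fin m) k} (h : TWon k m e a) :
    ∃ α, TWonBy k α m e a := by
  induction h with
  | move Φ w sel h0 hdet hw1 hw hlive hsucc ih =>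
    rename_i a
    classical
    -- the value of a successor index `(c, D, G)`: the ordinal given by `ih` when the clause fires, else `0`
    let S := (Fin m → k) × (Fin (e + 1) → ℕ) × (Fin (e + 1) → MvPowerSeries (Fin (m + 1)) k)
    let F : S → Ordinal.{0} := fun x =>
      if hx : ∃ (h1 : ∀ i, w i = 0 → x.1 i = 0) (h2 : x.1 ≠ 0)
          (h3 : ∀ j, a j ≠ 0 → subst (CobordantChart.chart w x.1) (subst Φ (a j)) = X 0 ^ x.2.1 j * x.2.2 j ∧
            ¬ X 0 ∣ x.2.2 j)
          (h4 : newTuple a x.2.1 x.2.2 (sel x.1 x.2.1 x.2.2) ≠ 0),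
          Bad (newTuple a x.2.1 x.2.2 (sel x.1 x.2.1 x.2.2))
      then Classical.choose (ih x.1 hx.1 hx.2.1 x.2.1 x.2.2 hx.2.2.1 hx.2.2.2.1 hx.2.2.2.2) + 1 else 0
    refine ⟨iSup F, ?_⟩
    rw [tWonBy_iff]
    refine ⟨Φ, w, sel, h0, hdet, hw1, hw, fun c hc0 hc D G hDG => ?_⟩
    refine ⟨hlive c hc0 hc D G hDG, fun hne hbad => ?_⟩
    have hx : ∃ (h1 : ∀ i, w i = 0 → c i = 0) (h2 : c ≠ 0)
        (h3 : ∀ j, a j ≠ 0 → subst (CobordantChart.chart w c) (subst Φ (a j)) = X 0 ^ D j * G j ∧ ¬ X 0 ∣ G j)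
        (h4 : newTuple a D G (sel c D G) ≠ 0), Bad (newTuple a D G (sel c D G)) := ⟨hc0, hc, hDG, hne, hbad⟩
    refine ⟨Classical.choose (ih c hx.1 hx.2.1 D G hx.2.2.1 hx.2.2.2.1 hx.2.2.2.2), ?_,
      Classical.choose_spec (ih c hx.1 hx.2.1 D G hx.2.2.1 hx.2.2.2.1 hx.2.2.2.2)⟩
    have hF : F ⟨c, D, G⟩ = Classical.choose (ih c hx.1 hx.2.1 D G hx.2.2.1 hx.2.2.2.1 hx.2.2.2.2) + 1 := by
      simp only [F, dif_pos hx]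
    have hle : F ⟨c, D, G⟩ ≤ iSup F := Ordinal.le_iSup F ⟨c, D, G⟩
    rw [hF] at hle
    exact lt_of_lt_of_le (Order.lt_succ _) hle

/-- `TWon ↔ ∃ α, TWonBy α`. [OURS · folklore] -/
theorem tWon_iff_exists_tWonBy {m e : ℕ} (a : Fin (e + 1) → MvPowerSeries (Fin m) k) :
    TWon k m e a ↔ ∃ α, TWonBy k α m e a :=
  ⟨TWon.exists_tWonBy, fun ⟨_, h⟩ => h.tWon⟩

/-- The LEAST GAME VALUE of a tuple: the least `α` with `TWonBy α` (and `0` on tuples that are not won). [OURS · folklore] -/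
noncomputable def leastTRank (m e : ℕ) (a : Fin (e + 1) → MvPowerSeries (Fin m) k) : Ordinal.{0} :=
  sInf {α | TWonBy k α m e a}

/-- A won tuple is won by its least game value. [OURS · folklore] -/
theorem tWonBy_leastTRank {m e : ℕ} {a : Fin (e + 1) → MvPowerSeries (Fin m) k} (h : TWon k m e a) :
    TWonBy k (leastTRank (k := k) m e a) m e a := by
  obtain ⟨α, hα⟩ := h.exists_tWonBy
  exact csInf_mem (⟨α, hα⟩ : {α | TWonBy k α m e a}.Nonempty)

/-- The least game value is at most any value. [OURS · folklore] -/
theorem leastTRank_le {α : Ordinal.{0}} {m e : ℕ} {a : Fin (e + 1) → MvPowerSeries (Fin m) k}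
    (h : TWonBy k α m e a) : leastTRank (k := k) m e a ≤ α :=
  csInf_le (OrderBot.bddBelow _) h

/-- RANK EXTRACTION: if every non-zero bad tuple is won, the tuple game `Drop k m e` is won (`κ :=` the least game value).
[OURS · folklore] -/
theorem drop_of_allTWon {m e : ℕ}
    (h : ∀ a : Fin (e + 1) → MvPowerSeries (Fin m) k, a ≠ 0 → Bad a → TWon k m e a) : Drop k m e := by
  refine ⟨leastTRank (k := k) m e, fun a ha hbad => ?_⟩
  have hW := tWonBy_leastTRank (h a ha hbad)
  rw [tWonBy_iff] at hW
  obtain ⟨Φ, w, sel, hmv⟩ := hW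
  rw [← isTMove_iff_stepDrop]
  exact ⟨Φ, w, sel, hmv.mono fun b _ _ ⟨β, hβ, hb⟩ => ⟨trivial, lt_of_le_of_lt (leastTRank_le hb) hβ⟩⟩

/-- WINNING FROM A RANK: if `Drop k m e` holds, every non-zero bad tuple is won (transfinite induction on the rank).
[OURS · folklore] -/
theorem allTWon_of_drop {m e : ℕ} (h : Drop k m e) :
    ∀ a : Fin (e + 1) → MvPowerSeries (Fin m) k, a ≠ 0 → Bad a → TWon k m e a := by
  obtain ⟨κ, hκ⟩ := h
  suffices key : ∀ (α : Ordinal.{0}) (a : Fin (e + 1) → MvPowerSeries (Fin m) k),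
      κ a = α → a ≠ 0 → Bad a → TWon k m e a from fun a ha hbad => key _ a rfl ha hbad
  intro α
  induction α using WellFoundedLT.induction with
  | ind α ih =>
    intro a hα ha hbad
    have hstep := hκ a ha hbad
    rw [← isTMove_iff_stepDrop] at hstep
    obtain ⟨Φ, w, sel, hmv⟩ := hstep
    exact TWon.of_isTMove (hmv.mono fun b hb hbad ⟨_, hlt⟩ => ih (κ b) (hα ▸ hlt) b rfl hb hbad)

/-- THE EQUIVALENCE: the tuple game is won by a rank iff every non-zero bad tuple is in the inductive winning region.
[OURS · folklore] -/
theorem drop_iff_allTWon {m e : ℕ} :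
    Drop k m e ↔ ∀ a : Fin (e + 1) → MvPowerSeries (Fin m) k, a ≠ 0 → Bad a → TWon k m e a :=
  ⟨allTWon_of_drop, drop_of_allTWon⟩

end Summit.ResolutionOfSingularities.ResolutionOfSingularities.Theorems.TupleGame
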